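import Summits.QuantumFields.BalabanUV.T4Continuum.Spine.NE2KingTransplant
import Literature.MathematicalPhysics.QuantumFieldTheory.Balaban1983to89.T4Cov2156Rate

/-!
# T⁴ programme, spine node NE2 (U1a) — THE KING TRANSPLANT, unit layer in Bałaban's δ-CONSTRAINT covariance shape
# `C^{(k)} = C(C*Δ_kC)⁻¹C*`: the tower assembly via the generic constrained resolvent identity of lineage t4-ne2-p2

Cell `pub-balaban`, unit `b2b-balaban-t4-ne2-p3` (ROUND-2 technique-distinct prover #3 on BINDER row NE2, literature
transplant); companion of `Spine/NE2KingTransplant` (p206677; King's Lemma 4.5 as a TOWER statement in the Gaussian-weight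
shape `(Δ^{(k)} + aL⁻²Q*Q)⁻¹` of [King1986] (2.16)) and of the skeleton `t4/skeletons/NE2-t4-ne2-p3.md` (leaf L02c, §3).

WHY A SECOND SHAPE.  Bałaban's pure Yang–Mills renormalization transformations are δ-function transformations ([B5] =
[Balaban1984PropagatorsI] (1.17) p. 20 «((ST)^k e^{−S})(B) = z^{(k)}∫dA δ(B − Q_kA)δ_Ax(Q_{k−1}A)·…·δ_Ax(A)e^{−S^η(A)}»), so
the unit-lattice fluctuation covariance is the CONSTRAINED inverse [B6] = [Balaban1984PropagatorsII] (2.156) p. 250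
«C^{(k)}_Λ = C(C*Δ_kC)^{−1}C*» (at a background: [B9] = [Balaban1985BackgroundPropagators] (3.185) p. 432), not King's
`(Δ^{(k)} + B)⁻¹`.  Lineage t4-ne2-p2 transplanted King's Lemma 4.5 to (2.156) AT `U = 1`, hypothesis-free
(`T4Cov2156Rate.cov2156_rate_torus`, p185201), through a GENERIC constrained resolvent identity over arbitrary finite index
types: `redCov E Δ := E(EᵀΔE)⁻¹Eᵀ`, `redCov_sub`, `redCov_rate` («two decaying constrained covariances around a small decaying
middle factor give King's (4.41) bound»).  THIS FILE is the TOWER form of that step with the leaves of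
`Spine/NE2KingTransplant`: for ANY tower `k ↦ D k` of unit-lattice effective operators (at a background, `Δ_k(U^{(k)})` — the
background enters only through the leaves) and a fixed elimination matrix `E` (Bałaban's `C`: δ(QB)·δ_{Ax}, level-
independent), (H2c) uniform decay of the constrained covariances ∧ (H2′) uniform decay of the operators ∧ (H3) their one-step
sup rate ∧ (H4) volume sum ⟹ King's (4.38) for the constrained tower, rate `√r` per step (`constrainedCovarianceTowerRate_of
_leaves`).  In this shape King's (4.33)/(4.34) (coercivity + Combes–Thomas) are consumed INSIDE (H2c) — exactly as [B6]
p. 250 phrases it: «The inequality (2.153) implies ⟨B′, C*Δ_kCB′⟩ ≥ … ≥ γ′₀‖B′‖² (2.157) … It gives us an exponential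
decay, and all the other properties, for the operator (C*Δ_kC)^{−1}, hence for C^{(k)}_Λ also.»

HONEST FRAMING.  [folklore] bookkeeping (one `√`-algebra step + the two imported theorems BY NAME); no carrier of Bałaban's
`C^{(k)}(Λ; U)` is constructed; `UniformConstrainedDecay` at `U ≠ 1` is a HYPOTHESIS SHAPE (the printed KIND [B9] Thm 3.15
(3.187), η-uniform, under the cell's audit G-B9-10), asserted by nobody; nothing printed is asserted.  NOT summit progress;
spine 0/9; NOT infinite volume, NOT mass gap, NOT Clay.  HONEST DEPENDENCY: continuum YM on T⁴ ⇐ BetaPertH ∧ nine spine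
estimates (0/9 proved); BetaPertH ⇐ (D1) ∧ (D4) ∧ CAP+tail; G-an2-4 gates asym, D1 and NE2/3/4.
-/

noncomputable section

open Matrix Finset Real
open Summit.QuantumFields.BalabanUV.T4Continuum.NE2KingTransplant (IsPseudoMetric UniformKernelDecay
  EffectiveOperatorSupRate VolumeSum)

namespace Summit.QuantumFields.BalabanUV.T4Continuum.NE2KingTransplantConstrained

variable {n : Type*} [Fintype n] [DecidableEq n]

section constrained

open Literature.MathematicalPhysics.QuantumFieldTheory.Balaban1983to89.T4Cov2156Rate (redCov redCov_rate)
open Literature.MathematicalPhysics.QuantumFieldTheory.King1986 (sub_kernel_rate)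

variable {S : Type*} [Fintype S] [DecidableEq S]

/-- **ROOT of the unit layer, δ-constraint shape**: the tower of constrained covariances `E(EᵀD_kE)⁻¹Eᵀ`
(`T4Cov2156Rate.redCov E (D k)`; `E` = Bałaban's elimination matrix `C` of [B6] p. 250, the same at every level since the
unit lattice and the constraints δ(QB)δ_{Ax} do not depend on `k`) has King's (4.38) rate at every level. [folklore] -/
def ConstrainedCovarianceTowerRate (E : Matrix n S ℝ) (D : ℕ → Matrix n n ℝ) (d : n → n → ℝ) (C κ' s : ℝ) :
    Prop :=
  ∀ k x y, |redCov E (D k) x y - redCov E (D (k + 1)) x y| ≤ C * s ^ k * Real.exp (-(κ' * d x y))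

/-- **Leaf (H2c) — uniform decay of the constrained covariances themselves** (the printed KIND: [B6] p. 250 «It gives
us an exponential decay, and all the other properties, for the operator (C*Δ_kC)^{−1}, hence for C^{(k)}_Λ also»;
[B9] Thm 3.15 (3.187) p. 432 at a background, η-uniform, under audit; at `U = 1` KERNEL: `T4Cov2156Rate` /
`B6Cov2156Subset166.cov2156_torusS_166`).  In the δ-shape this one-run leaf replaces (H1) ∧ (H2): King's Combes–Thomas step
is consumed already inside it. ONE-RUN, no spacing difference. [folklore] -/
def UniformConstrainedDecay (E : Matrix n S ℝ) (D : ℕ → Matrix n n ℝ) (d : n → n → ℝ) (A κ : ℝ) : Prop :=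
  ∀ k x y, |redCov E (D k) x y| ≤ A * Real.exp (-(κ * d x y))

omit [DecidableEq n] in
/-- **THE UNIT-LAYER ASSEMBLY, δ-CONSTRAINT SHAPE (kernel-checked).**  Invertibility of every `EᵀD_kE` ((2.157)-type
constrained coercivity), uniform decay `A·e^{−κd}` of the constrained covariances, uniform decay `C₁e^{−2κd}` of the
effective operators, their one-step sup rate `ε·r^k` and the volume sum give King's (4.38) for the constrained tower
with rate `(√r)^k`, constant `A²√(2C₁ε)V²`, decay `κ/2`.  Proof = `King1986.sub_kernel_rate` (sup rate ↦ position-space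
rate at half decay) + `T4Cov2156Rate.redCov_rate` at each level. [folklore] -/
theorem constrainedCovarianceTowerRate_of_leaves (E : Matrix n S ℝ) (D : ℕ → Matrix n n ℝ) (d : n → n → ℝ)
    {κ A ε C₁ V r : ℝ} (hd : IsPseudoMetric d) (hκ : 0 ≤ κ) (hA : 0 ≤ A) (hε : 0 ≤ ε) (hr : 0 ≤ r)
    (hU : ∀ k, IsUnit ((Eᵀ * D k * E).det)) (hdec : UniformConstrainedDecay E D d A κ)
    (h2' : UniformKernelDecay D d C₁ κ) (h3 : EffectiveOperatorSupRate D ε r) (h4 : VolumeSum d κ V) :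
    ConstrainedCovarianceTowerRate E D d (A * Real.sqrt (ε * (2 * C₁)) * A * V ^ 2) (κ / 2) (Real.sqrt r) := by
  unfold ConstrainedCovarianceTowerRate
  intro k x y
  have hEk : ∀ z w, |(D (k + 1) - D k) z w| ≤ Real.sqrt (ε * r ^ k * (2 * C₁)) * Real.exp (-(κ * d z w)) :=
    sub_kernel_rate (D k) (D (k + 1)) d (mul_nonneg hε (pow_nonneg hr k)) (fun z w => h3 k z w) (h2' k)
      (h2' (k + 1))
  have key := redCov_rate d hd.nonneg hd.tri E (D k) (D (k + 1)) (hU k) (hU (k + 1)) hκ hA (Real.sqrt_nonneg _)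
    (hdec k) (hdec (k + 1)) hEk h4 x y
  have hsq : Real.sqrt (r ^ k) = Real.sqrt r ^ k := by
    have h0 : 0 ≤ Real.sqrt r ^ k := pow_nonneg (Real.sqrt_nonneg r) k
    have e : r ^ k = (Real.sqrt r ^ k) ^ 2 := by
      rw [← pow_mul, mul_comm, pow_mul, Real.sq_sqrt hr]
    rw [e, Real.sqrt_sq h0]
  have hs : Real.sqrt (ε * r ^ k * (2 * C₁)) = Real.sqrt (ε * (2 * C₁)) * Real.sqrt r ^ k := by
    rw [show ε * r ^ k * (2 * C₁) = (ε * (2 * C₁)) * r ^ k by ring, Real.sqrt_mul' _ (pow_nonneg hr k), hsq]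
  calc |redCov E (D k) x y - redCov E (D (k + 1)) x y|
      ≤ A * Real.sqrt (ε * r ^ k * (2 * C₁)) * A * V ^ 2 * Real.exp (-(κ / 2 * d x y)) := key
    _ = A * Real.sqrt (ε * (2 * C₁)) * A * V ^ 2 * Real.sqrt r ^ k * Real.exp (-(κ / 2 * d x y)) := by
          rw [hs]; ring

end constrained

end Summit.QuantumFields.BalabanUV.T4Continuum.NE2KingTransplantConstrained

end
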